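import Summits.BirchSwinnertonDyer.BirchSwinnertonDyer.Theorems.ClassRecordThreeCornerAtThreeBranchesDefs
import Literature.NumberTheory.EllipticCurves.KellerYin2024.AnomalousLambdaInvariants
import Literature.NumberTheory.EllipticCurves.EmertonPollackWeston2006.HidaFamilyTransfer
import HarnessLib

/-!
# Crux idea sketch (item 19111 `CornerAtThree`, TWIST conjunct, LOWER half) —
# «weight-one CM anchor at the 3-ramified CM field» (seat bsd-stepL-mult-idea g3)

The corner at `3` (`ClassX11b W 3 ∧ ¬ Surj W 3`, image `N(C_s)` of order `∣ 8` or `N(C_ns)` of order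
`∣ 16`) is EXACTLY the locus where `3 ∤ #im ρ̄_{E,3}`: Greenberg–Vatsal's Hypothesis A
(arXiv:1806.05659, p. 2) holds for the Teichmüller lift `ρ̃` of `E[3]`, an odd dihedral ARTIN
representation `ρ̃ = Ind_{K_θ}^ℚ ψ̃` (`K_θ` imaginary quadratic, `3` RAMIFIED in `K_θ`,
`(K_θ)_𝔭 = ℚ₃(√-3)`, `ψ̃` of `2`-power order, unramified at `𝔭 ∣ 3`; `ρ̃|_{I_3} = ω ⊕ 1`), i.e. of a
`3`-ordinary, `3`-distinguished CM weight-ONE newform `θ = θ_ψ̃` (`U_3`-eigenvalue `ψ̃(𝔭) = a_3 = ±1`,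
nebentypus `χ_{-3}`).  The Hida family `H(ρ̄)` through the rank-`0` twin `Wd` passes through `θ`
(a NON-CM family: Dimitrov–Ghate 2012 §6, the «Δ mod 23» phenomenon).  Emerton–Pollack–Weston
transport of `(μ, λ)` along `H(ρ̄)` + Greenberg–Vatsal's weight-one algebra make
`DEFECT(ρ̄) := λ^an − λ^alg` constant on `H(ρ̄) ∪ {θ}`; Kato (rational divisibility, no image
hypothesis) gives `DEFECT ≥ 0`; the missing LOWER half at the twin is `DEFECT ≤ 0`, i.e. the
weight-one inequality `λ(θ^an_{χ,ε}) ≤ λ(θ^al_{χ,ε})` (W1) where `θ^al = Col_ε(elliptic units of K_θ)`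
is CLASSICAL (GV Thm. 3 shape; Johnson-Leung–Kings 2011 all-`p` CM main conjecture) and
`θ^an` is the Mazur–Kitagawa two-variable `L`-function of the branch at the weight-one point
(GV §5).  W1 = the Greenberg–Vatsal main conjecture for `ρ̃` at a prime RAMIFIED in the CM field:
OPEN in print (known for `p` split in `K_θ`: Maksoud 2023; per residual class a FINITE `3`-adic
computation once `μ = 0`).

This file types only the NUMERICAL SHADOW of the anchor over existing declarations (no Hida
family / GV Selmer group exists in the tree): an interface `AnchorShadow` (data, NO existence
claim), the three transport/anchor statements as `Prop`s, the kernel bookkeeping lemma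
`twinLambdaLe_of_anchor`, and the typed candidate `CornerTwinLambdaLeAt3` (the TWIST-lower half in
`λ`-currency on every corner twin frame).  Nothing is asserted; every `def … : Prop` is a
hypothesis by name.  Downstream (not typed here): `λ`-inequality + Kato Thm. 17.4 (rational) +
`μ^an = μ^alg = 0` (items TwistMuAn/TwistMu) ⟹ `MultiplicativeCharIdealMuZero Wd 3` by the tree's
numerical-criterion algebra (`X1.KellerYinHalves.span_singleton_eq_of_C_pow_mul_mem` pattern) ⟹
`BSDp Wd 3` by `X11RankZero.bsdp_of_multCharIdealMuZero_{split,nonsplit}`.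
-/

noncomputable section

open scoped Classical NumberField

open WeierstrassCurve NumberField IsDedekindDomain Field PowerSeries CongruenceSubgroup
  Literature.NumberTheory.EllipticCurves Literature.NumberTheory.EllipticCurves.ModularForms
  Literature.NumberTheory.EllipticCurves.Rank1Residual
  Literature.NumberTheory.EllipticCurves.KellerYin2024
  Literature.NumberTheory.EllipticCurves.EmertonPollackWeston2006
  Literature.NumberTheory.GaloisRepresentations
  Summit.BirchSwinnertonDyer.Rank1Residual Summit.BirchSwinnertonDyer.Rank1Residual.X11b
  Summit.BirchSwinnertonDyer.Rank1Residual.X11b.Three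
  Summit.BirchSwinnertonDyer.BirchSwinnertonDyer.Theorems

set_option linter.dupNamespace false
set_option autoImplicit false

namespace Summit.BirchSwinnertonDyer.BirchSwinnertonDyer.Cruxes.CornerAtThree.WeightOneAnchor

/-- `μ(L) = 0 ∧ λ(L) = n` for a `ℤ_p`-valued power series read in `ℚ_p`: the `n`-th coefficient is
a unit and the earlier ones are non-units (Weierstrass preparation; Washington §7.1). The twin-side
analogue of the tree's `FirstUnitCoeffAt` (which lives over `W(𝔽̄_p)⟦T⟧`). -/
def FirstUnitCoeffQ (p : ℕ) [Fact p.Prime] (L : PowerSeries ℚ_[p]) (n : ℕ) : Prop :=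
  ‖PowerSeries.coeff n L‖ = 1 ∧ ∀ i < n, ‖PowerSeries.coeff i L‖ < 1

/-- The exceptional-zero shift at a multiplicative prime: `λ(L_p^{MTT}) = λ(char X) + 1` at SPLIT
multiplicative `3` (the factor `T` in `MultiplicativeCharIdealMuZero`), `+ 0` otherwise. -/
def splitShift (Wd : WeierstrassCurve ℚ) : ℕ :=
  if Wd.HasSplitMultiplicativeReductionAtPrime 3 then 1 else 0

/-- **INTERFACE (data only, no existence smuggled).** The numerical shadow of the weight-one anchor
of a corner twin `Wd` at `p = 3`: GV's analytic and algebraic weight-one power series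
`θ^an_{χ,ε}, θ^al_{χ,ε} ∈ Λ_𝒪 = 𝒪⟦T⟧` (`𝒪 = ℤ₃[values of ψ̃]`, unramified over `ℤ₃` since `ψ̃`
has `2`-power order, read in `W(𝔽̄₃)⟦T⟧ = UnrSeries 3`) for the Artin representation
`ρ̃ = Ind_{K_θ}^ℚ ψ̃` lifting `Wd[3]`, with `ε` THE ramified character of `Δ_𝔭` (multiplicity one),
and the Emerton–Pollack–Weston Euler-factor correction `corr = Σ_ℓ (e_ℓ(f_{Wd}) − e_ℓ(θ))` between
the twin's branch and the (minimal) branch through `θ`. The links to `Wd` are the `Prop`s below. -/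
structure AnchorShadow (Wd : WeierstrassCurve ℚ) where
  /-- `θ^an_{χ,ε}`: the Mazur–Kitagawa two-variable `L`-function of the branch through `θ`,
  specialised at the weight-one point (Greenberg–Vatsal 2020 §5). -/
  thetaAn : UnrSeries 3
  /-- `θ^al_{χ,ε}`: a generator of the characteristic ideal of `X_{χ,ε}(ℚ_∞)` (GV 2020 Thm. 1),
  `= Col_ε(elliptic units of K_θ)` up to a unit by GV Thm. 3-shape + the CM main conjecture of `K_θ`. -/
  thetaAl : UnrSeries 3
  /-- EPW's cross-branch `λ`-correction `Σ_ℓ (e_ℓ(f_{Wd}) − e_ℓ(θ))` (the same on both sides, EPW §5). -/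
  corr : ℤ

variable {Wd : WeierstrassCurve ℚ} [Wd.IsElliptic] [Wd.IsGloballyMinimal]

/-- **S-AN (support; EPW Thm. 1 + GV §5–6 at `p = 3`, including the weight-one point)** — analytic
`λ`-transport: for THE `3`-adic `L`-function of the twin (Néron-normalised by `ϖ`, `μ = 0` with
`λ = n`) and `λ(θ^an) = m`: `n − m = corr`. In print for `p ≥ 5` members of weight `≥ 2`
(EPW 2006 Thm. 1/3.7.7); the weight-one endpoint is GV 2020 §5 (definition of `θ^an` by
specialisation); at `p = 3` the Hida control (EPW Thm. 2.1.2) is the shared caveat S1. -/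
def AnchorShadow.AnalyticTransfer (A : AnchorShadow Wd) : Prop :=
  ∀ {N : ℕ} [NeZero N] (f : CuspForm (Gamma0 N) 2), IsNewformOf Wd f →
    ∀ (ϖ : ℚ), (ϖ : ℝ) * Wd.realPeriodRat = plusPeriod f →
    ∀ (a : ℚ_[3]) (L : PowerSeries ℚ_[3]),
      (Wd.HasSplitMultiplicativeReductionAtPrime 3 → a = 1) →
      (¬ Wd.HasSplitMultiplicativeReductionAtPrime 3 → a = -1) →
      IsMultPAdicLFunctionOf f 3 a L →
      ∀ (n m : ℕ), FirstUnitCoeffQ 3 (PowerSeries.C ((ϖ : ℚ) : ℚ_[3]) * L) n →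
        FirstUnitCoeffAt A.thetaAn m → (n : ℤ) - m = A.corr

/-- **S-ALG (support; EPW Thm. 2/§4 + GV 2020 §3–4 weight-one control at `p = 3`)** — algebraic
`λ`-transport: for every cyclotomic dual Selmer datum `D` of the twin with `μ = 0` and
`λ(θ^al) = m'`: `(λ(D) + shift) − m' = corr` (exact residual-Selmer control at weight one:
`3 ∤ #Δ`, `ε` of multiplicity one — GV Hypothesis A). -/
def AnchorShadow.AlgebraicTransfer (A : AnchorShadow Wd) : Prop :=
  ∀ (κ : ZpExtension ℚ 3) (γ : Field.absoluteGaloisGroup ℚ),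
    κ.IsCyclotomic → κ.IsTopGenerator γ → IsCyclotomicVariable 3 γ →
    ∀ (D : Wd.SelmerDualData κ γ), D.IsTorsion → D.mu = 0 →
      ∀ m' : ℕ, FirstUnitCoeffAt A.thetaAl m' → ((D.lambda + splitShift Wd : ℕ) : ℤ) - m' = A.corr

/-- `μ(θ^an) = 0` and `θ^an ≠ 0` — obtained from ONE certificate `μ^an(Wd) = 0` (item TwistMuAn) by
EPW `μ`-transport to the weight-one point (answers GV 2020 Rem. 5.3/5.5 «we cannot rule out
`θ^an = 0`» on the corner). -/
def AnchorShadow.ThetaAnMuZero (A : AnchorShadow Wd) : Prop :=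
  ∃ m : ℕ, FirstUnitCoeffAt A.thetaAn m

/-- `μ(θ^al) = 0` — from Kato at the twin (`μ^alg ≤ μ^an = 0`) by EPW Thm. 2 transport. -/
def AnchorShadow.ThetaAlMuZero (A : AnchorShadow Wd) : Prop :=
  ∃ m' : ℕ, FirstUnitCoeffAt A.thetaAl m'

/-- **W1 — THE CRUX (weight-one anchor inequality; = Greenberg–Vatsal's main conjecture for the
dihedral Artin representation `ρ̃` at a prime RAMIFIED in its CM field, lower half):**
`λ(θ^an_{χ,ε}) ≤ λ(θ^al_{χ,ε})`. OPEN in print (`p` split in `K_θ`: known, Maksoud 2023 §1;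
`p` inert: Maksoud proves only EX/EZC; `p` ramified: nothing). Equivalent, by rank-one rigidity of
`H¹_Iw(K_θ·ℚ_∞, ψ̃)`, to «the weight-one specialisation of Ochiai's `Λ`-adic Kato class generates,
up to `3`-power, the elliptic-unit line» — a `3`-adic Kronecker limit formula at a non-split CM
weight-one point of a non-CM Hida family. -/
def AnchorShadow.WeightOneInequality (A : AnchorShadow Wd) : Prop :=
  ∀ m m' : ℕ, FirstUnitCoeffAt A.thetaAn m → FirstUnitCoeffAt A.thetaAl m' → m ≤ m'

omit [Wd.IsElliptic] [Wd.IsGloballyMinimal] in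
/-- **KERNEL (bookkeeping): the anchor delivers the twin's missing `λ`-inequality.**
S-AN + S-ALG + `μ(θ^an) = μ(θ^al) = 0` + W1 ⟹ `λ^an(Wd) ≤ λ^alg(Wd) + shift`. [folklore] -/
theorem twinLambdaLe_of_anchor (A : AnchorShadow Wd) (han : A.AnalyticTransfer)
    (halg : A.AlgebraicTransfer) (hW1 : A.WeightOneInequality) (hμan : A.ThetaAnMuZero)
    (hμal : A.ThetaAlMuZero) {N : ℕ} [NeZero N] (f : CuspForm (Gamma0 N) 2) (hf : IsNewformOf Wd f)
    (ϖ : ℚ) (hϖ : (ϖ : ℝ) * Wd.realPeriodRat = plusPeriod f) (a : ℚ_[3]) (L : PowerSeries ℚ_[3])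
    (ha1 : Wd.HasSplitMultiplicativeReductionAtPrime 3 → a = 1)
    (ha2 : ¬ Wd.HasSplitMultiplicativeReductionAtPrime 3 → a = -1) (hL : IsMultPAdicLFunctionOf f 3 a L)
    (κ : ZpExtension ℚ 3) (γ : Field.absoluteGaloisGroup ℚ) (hκ : κ.IsCyclotomic)
    (hγ : κ.IsTopGenerator γ) (hγ' : IsCyclotomicVariable 3 γ) (D : Wd.SelmerDualData κ γ)
    (hT : D.IsTorsion) (hμ : D.mu = 0) (n : ℕ)
    (hn : FirstUnitCoeffQ 3 (PowerSeries.C ((ϖ : ℚ) : ℚ_[3]) * L) n) :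
    n ≤ D.lambda + splitShift Wd := by
  obtain ⟨m, hm⟩ := hμan
  obtain ⟨m', hm'⟩ := hμal
  have h1 : (n : ℤ) - m = A.corr := han f hf ϖ hϖ a L ha1 ha2 hL n m hn hm
  have h2 : ((D.lambda + splitShift Wd : ℕ) : ℤ) - m' = A.corr := halg κ γ hκ hγ hγ' D hT hμ m' hm'
  have h3 : m ≤ m' := hW1 m m' hm hm'
  omega

/-- **TYPED CANDIDATE PROP (the card's transfer target C⁺ in twin currency = «DEFECT(ρ̄) ≤ 0»):
the TWIST-lower half on every corner twin frame, in `λ`-currency.** Binder prefix VERBATIM that of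
`Theorems.CornerAtThreeTwistLower` / `…TwistMuAn`; conclusion: for THE `3`-adic `L`-function of the
twin with `μ = 0, λ = n` and every torsion cyclotomic dual Selmer datum with `μ = 0`:
`n ≤ λ(D) + shift`. With Kato Thm. 17.4 (rational divisibility: `λ(D) + shift ≤ n`) and the two
`μ = 0` items this is the integral main conjecture `MultiplicativeCharIdealMuZero Wd 3`, whence
`BSDp Wd 3` (`X11RankZero.bsdp_of_multCharIdealMuZero_{split,nonsplit}`). OPEN; nothing asserted. -/
@[conjecture]
def CornerTwinLambdaLeAt3 : Prop :=
  ∀ (W : WeierstrassCurve ℚ) [W.IsElliptic] [W.IsGloballyMinimal] (K : Type) [Field K] [NumberField K]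
    (Wd : WeierstrassCurve ℚ) [Wd.IsElliptic] [Wd.IsGloballyMinimal] (Cd : VariableChange ℚ),
    ClassX11b W 3 → ¬ Surj W 3 → IsImaginaryQuadratic K → Odd (NumberField.discr K) →
    SatisfiesHeegnerHypothesis (W.conductorNorm ℤ) K →
    (W.quadraticTwist (NumberField.discr K : ℚ)).entireLFunction 1 ≠ 0 →
    Cd • W.quadraticTwist (NumberField.discr K : ℚ) = Wd →
    ∀ {N : ℕ} [NeZero N] (f : CuspForm (Gamma0 N) 2), IsNewformOf Wd f →
    ∀ (ϖ : ℚ), (ϖ : ℝ) * Wd.realPeriodRat = plusPeriod f →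
    ∀ (a : ℚ_[3]) (L : PowerSeries ℚ_[3]),
      (Wd.HasSplitMultiplicativeReductionAtPrime 3 → a = 1) →
      (¬ Wd.HasSplitMultiplicativeReductionAtPrime 3 → a = -1) →
      IsMultPAdicLFunctionOf f 3 a L →
    ∀ (κ : ZpExtension ℚ 3) (γ : Field.absoluteGaloisGroup ℚ),
      κ.IsCyclotomic → κ.IsTopGenerator γ → IsCyclotomicVariable 3 γ →
      ∀ (D : Wd.SelmerDualData κ γ), D.IsTorsion → D.mu = 0 →
        ∀ n : ℕ, FirstUnitCoeffQ 3 (PowerSeries.C ((ϖ : ℚ) : ℚ_[3]) * L) n →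
          n ≤ D.lambda + splitShift Wd

/-- **The anchor package on the corner (W1 + its two transports + the two `μ = 0` inputs, per twin
frame) — the line's hypothesis BY NAME.** An honest `∀ frame, ∃ shadow, …` packaging: as pure
numerics it carries exactly the content of its consequence `CornerTwinLambdaLeAt3` (see the kernel
lemma); the mathematics lives in the three named statements S-AN, S-ALG, W1 about objects the tree
does not yet have (definition requests: `HidaFamilyOfResidualRep`, `GVSelmerGroupWeightOne`,
`MazurKitagawaTwoVariableL`). OPEN; nothing asserted. -/
@[conjecture]
def CornerWeightOneAnchorAt3 : Prop :=
  ∀ (W : WeierstrassCurve ℚ) [W.IsElliptic] [W.IsGloballyMinimal] (K : Type) [Field K] [NumberField K]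
    (Wd : WeierstrassCurve ℚ) [Wd.IsElliptic] [Wd.IsGloballyMinimal] (Cd : VariableChange ℚ),
    ClassX11b W 3 → ¬ Surj W 3 → IsImaginaryQuadratic K → Odd (NumberField.discr K) →
    SatisfiesHeegnerHypothesis (W.conductorNorm ℤ) K →
    (W.quadraticTwist (NumberField.discr K : ℚ)).entireLFunction 1 ≠ 0 →
    Cd • W.quadraticTwist (NumberField.discr K : ℚ) = Wd →
    ∃ A : AnchorShadow Wd, A.AnalyticTransfer ∧ A.AlgebraicTransfer ∧ A.ThetaAnMuZero ∧
      A.ThetaAlMuZero ∧ A.WeightOneInequality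

/-- **KERNEL: the anchor package implies the typed candidate** (frame-by-frame application of
`twinLambdaLe_of_anchor`). [folklore] -/
theorem cornerTwinLambdaLeAt3_of_anchor (h : CornerWeightOneAnchorAt3) : CornerTwinLambdaLeAt3 := by
  intro W _ _ K _ _ Wd _ _ Cd hX hns hK hodd hheeg hL1 hCd N _ f hf ϖ hϖ a L ha1 ha2 hL κ γ hκ hγ hγ' D
    hT hμ n hn
  obtain ⟨A, han, halg, hμan, hμal, hW1⟩ := h W K Wd Cd hX hns hK hodd hheeg hL1 hCd
  exact twinLambdaLe_of_anchor A han halg hW1 hμan hμal f hf ϖ hϖ a L ha1 ha2 hL κ γ hκ hγ hγ' D hT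
    hμ n hn

end Summit.BirchSwinnertonDyer.BirchSwinnertonDyer.Cruxes.CornerAtThree.WeightOneAnchor

end
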